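import Summits.CriticalPhenomena.SAWScalingLimit.Theorems.SAWTensorRGRestrictionOfLimitRadoLevel
import Mathlib.Topology.Algebra.Order.Archimedean
import HarnessLib

/-!
# Radó squeezes, part 12: the level domain with its loop; the squeeze family, containment, separation

Support file (`--supports stmt-CriticalPhenomena-0773`, towards the registered stub `stub_radoSqueezeFamily`,
geometry F′ of the line `birth` for the crux `RestrictionOfLimit`). Pure plane topology.

First the loop of part 10 on the window `[m₀, m₀ + 1]` is periodised through `Int.fract` (`loopγ`): continuous,
`1`-periodic, injective on a period, through the marked points at the marks of `D'`, with range the image of the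
window; since that range lies in the frontier of the squeezed domain of part 11 it EQUALS it (a Jordan curve
contains no proper Jordan sub-curve, part 7), so the squeezed domain at level `η` with treated set `S` is a
Dobrushin domain with boundary loop `loopγ η S` (`exists_level`).

The boundary-controlled outer squeeze: for `0 < t < 1/4` the TREATED SET is the set of representatives
`n < ⌊1/t⌋` (first hits of the free arcs by the sequence `xs`), and `levelE t` is the level domain of part 11 at
level `η = t` with this treated set (so its boundary loop is `loopγ t (treated t)`); `levelE t = D` otherwise.
Here: the defining properties (`levelE_spec`), `D' ⊆ levelE t ⊆ D` with the marked points of `D`, the key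
lemma that chart points above level `s` of a treated index are off `closure (levelE s)` (`G_notMem_closure_level`),
and SEPARATION `closure (levelE s) ∩ closure (D ∖ levelE t) = ∅` for `0 < s < t`.

Axioms `propext`, `Classical.choice`, `Quot.sound`.
-/

noncomputable section

open Set Filter Topology Metric Complex
open Literature.Topology.PlaneTopology Literature.Probability.RandomPlanarGeometry
open scoped Classical

namespace Summit.CriticalPhenomena.SAWScalingLimit.Theorems.RestrictionOfLimit.Birth

section Periodic

variable {D D' : DobrushinDomain} {F : Set ℝ} (xs : ℕ → ℝ)
  (d : ∀ n : ℕ, xs n ∈ F ∧ xs n ∈ Ioo (D'.mark 0) (D'.mark 0 + 1) → DefectData D D' F (xs n))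
  (hex : ∀ y : ℝ, y ∈ F ∧ y ∈ Ioo (D'.mark 0) (D'.mark 0 + 1) →
    ∃ n : ℕ, (xs n ∈ F ∧ xs n ∈ Ioo (D'.mark 0) (D'.mark 0 + 1)) ∧ xs n ∈ connectedComponentIn F y)

/-- The **periodised loop** at level `η` with treated set `S`. [folklore] -/
def loopγ (η : ℝ) (S : Finset ℕ) (θ : ℝ) : ℂ :=
  loopΓ xs d hex η S (D'.mark 0 + Int.fract (θ - D'.mark 0))

variable (hF : F = {θ : ℝ | D'.boundary θ ∈ D.carrier}) (hsub : D'.carrier ⊆ D.carrier)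
  (h0 : D'.pt 0 = D.pt 0) (h1 : D'.pt 1 = D.pt 1)

/-! ### The periodised loop -/

include hF hsub h0 h1 in
/-- **The periodised loop**: continuous, `1`-periodic, injective on `[0, 1)`, with range the image of the window,
passing through the marked points at the marks of `D'`. [folklore] -/
theorem loopγ_facts {η : ℝ} (hη0 : 0 < η) (hη : η ≤ 1 / 4) (S : Finset ℕ) :
    Continuous (loopγ xs d hex η S) ∧ Function.Periodic (loopγ xs d hex η S) 1 ∧
      InjOn (loopγ xs d hex η S) (Ico 0 1) ∧
      range (loopγ xs d hex η S) = loopΓ xs d hex η S '' Ico (D'.mark 0) (D'.mark 0 + 1) ∧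
      loopγ xs d hex η S (D'.mark 0) = D.pt 0 ∧ loopγ xs d hex η S (D'.mark 1) = D.pt 1 ∧
      ∀ θ : ℝ, ∃ y ∈ Ico (D'.mark 0) (D'.mark 0 + 1), loopγ xs d hex η S θ = loopΓ xs d hex η S y ∧
        D'.boundary θ = D'.boundary y := by
  have hnot0 : ¬ ((D'.mark 0) ∈ F ∧ (D'.mark 0) ∈ Ioo (D'.mark 0) ((D'.mark 0) + 1)) := fun h ↦ lt_irrefl _ h.2.1
  have hnot1 : ¬ ((D'.mark 0) + 1 ∈ F ∧ (D'.mark 0) + 1 ∈ Ioo (D'.mark 0) ((D'.mark 0) + 1)) := fun h ↦ lt_irrefl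
      _ h.2.2
  have hΓc := continuous_loopΓ xs d hex hF hsub h0 h1 hη0 hη S
  have hwin : ∀ θ : ℝ, (D'.mark 0) + Int.fract (θ - (D'.mark 0)) ∈ Ico (D'.mark 0) ((D'.mark 0) + 1) := fun θ ↦
    ⟨by linarith [Int.fract_nonneg (θ - (D'.mark 0))], by linarith [Int.fract_lt_one (θ - (D'.mark 0))]⟩
  refine ⟨?_, fun θ ↦ ?_, ?_, ?_, ?_, ?_, fun θ ↦ ⟨_, hwin θ, rfl, ?_⟩⟩
  · -- continuity through `Int.fract`
    have hf : Continuous ((fun v : ℝ ↦ loopΓ xs d hex η S ((D'.mark 0) + v)) ∘ Int.fract) := by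
      refine ContinuousOn.comp_fract'' (hΓc.comp (continuous_const.add continuous_id)).continuousOn ?_
      simp only [add_zero]
      rw [loopΓ_of_not xs d hex η S hnot0, loopΓ_of_not xs d hex η S hnot1]
      exact (D'.periodic_boundary (D'.mark 0)).symm
    exact hf.comp (continuous_id.sub continuous_const)
  · show loopΓ xs d hex η S ((D'.mark 0) + Int.fract (θ + 1 - (D'.mark 0))) = loopΓ xs d hex η S ((D'.mark 0) +
      Int.fract (θ - (D'.mark 0)))
    rw [show θ + 1 - (D'.mark 0) = (θ - (D'.mark 0)) + 1 by ring, Int.fract_add_one]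
  · intro θ hθ θ' hθ' h
    have h' := loopΓ_injOn xs d hex hF hsub h0 h1 hη0 hη S (hwin θ) (hwin θ') h
    have hfr : Int.fract (θ - (D'.mark 0)) = Int.fract (θ' - (D'.mark 0)) := by linarith
    rw [Int.fract_eq_fract] at hfr
    obtain ⟨k, hk⟩ := hfr
    have hk' : (k : ℝ) = θ - θ' := by linarith
    have hk0 : k = 0 := by
      have h1' : (k : ℝ) < 1 := by rw [hk']; linarith [hθ.2, hθ'.1]
      have h2' : (-1 : ℝ) < k := by rw [hk']; linarith [hθ.1, hθ'.2]
      have := (Int.cast_lt (R := ℝ)).1 (show ((k : ℤ) : ℝ) < ((1 : ℤ) : ℝ) by simpa using h1')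
      have := (Int.cast_lt (R := ℝ)).1 (show ((-1 : ℤ) : ℝ) < ((k : ℤ) : ℝ) by simpa using h2')
      omega
    rw [hk0, Int.cast_zero] at hk'
    linarith
  · refine Subset.antisymm ?_ ?_
    · rintro _ ⟨θ, rfl⟩
      exact ⟨_, hwin θ, rfl⟩
    · rintro _ ⟨y, hy, rfl⟩
      refine ⟨y, ?_⟩
      show loopΓ xs d hex η S ((D'.mark 0) + Int.fract (y - (D'.mark 0))) = loopΓ xs d hex η S y
      rw [Int.fract_eq_self.2 ⟨by linarith [hy.1], by linarith [hy.2]⟩, add_sub_cancel]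
  · show loopΓ xs d hex η S ((D'.mark 0) + Int.fract ((D'.mark 0) - (D'.mark 0))) = D.pt 0
    rw [sub_self, Int.fract_zero, add_zero, loopΓ_of_not xs d hex η S hnot0, ← h0]
    rfl
  · show loopΓ xs d hex η S ((D'.mark 0) + Int.fract (D'.mark 1 - (D'.mark 0))) = D.pt 1
    have hm01 : (D'.mark 0) < D'.mark 1 := D'.strictMono_mark (by decide)
    have hm1' : D'.mark 1 < (D'.mark 0) + 1 := by linarith [(D'.mark_mem 1).2, (D'.mark_mem 0).1]
    have hnotF : D'.mark 1 ∉ F := by simpa using mark_add_int_notMem_free hF h0 h1 1 0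
    rw [Int.fract_eq_self.2 ⟨by linarith, by linarith⟩, add_sub_cancel,
      loopΓ_of_not xs d hex η S (fun h ↦ hnotF h.1), ← h1]
    rfl
  · rw [show (D'.mark 0) + Int.fract (θ - (D'.mark 0)) = θ - ((⌊θ - (D'.mark 0)⌋ : ℤ) : ℝ) * 1 by
      rw [Int.fract]; ring]
    exact (D'.periodic_boundary.sub_int_mul_eq ⌊θ - (D'.mark 0)⌋).symm

/-! ### The level domain -/

include hF hsub h0 h1 in
/-- **The squeezed domain at level `η` with treated set `S` is a Dobrushin domain with boundary loop `loopγ η S`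
and the marked points of `D`.** [folklore] -/
theorem exists_level {η : ℝ} (hη0 : 0 < η) (hη : η ≤ 1 / 4) (S : Finset ℕ)
    (hS : ∀ n ∈ S, (xs n ∈ F ∧ xs n ∈ Ioo (D'.mark 0) (D'.mark 0 + 1)) ∧
      ∀ k < n, xs k ∈ F ∧ xs k ∈ Ioo (D'.mark 0) (D'.mark 0 + 1) →
        connectedComponentIn F (xs k) ≠ connectedComponentIn F (xs n)) :
    ∃ E : DobrushinDomain, E.carrier = D.carrier \ ⋃ n ∈ S, bite xs d η n ∧ E.pt 0 = D.pt 0 ∧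
      E.pt 1 = D.pt 1 ∧ E.boundary = loopγ xs d hex η S := by
  obtain ⟨E₀, hE₀, hE₀0, hE₀1⟩ := exists_biteDomain xs d hF hsub h0 h1 hη0 hη S hS
  obtain ⟨hγc, hγp, hγi, hγr, hγ0, hγ1, -⟩ := loopγ_facts xs d hex hF hsub h0 h1 hη0 hη S
  have hrange : range (loopγ xs d hex η S) = frontier E₀.carrier := by
    rw [← E₀.range_boundary]
    refine range_eq_of_range_subset_loop E₀.continuous_boundary E₀.periodic_boundary E₀.injOn_boundary hγc hγp
      hγi ?_
    rw [E₀.range_boundary, hγr, hE₀]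
    rintro _ ⟨y, hy, rfl⟩
    exact loopΓ_mem_frontier xs d hex hF hsub h0 h1 hη0 hη S hS hy
  let E : DobrushinDomain :=
    { carrier := E₀.carrier
      boundary := loopγ xs d hex η S
      isOpen := E₀.isOpen
      isBounded := E₀.isBounded
      isConnected := E₀.isConnected
      continuous_boundary := hγc
      periodic_boundary := hγp
      injOn_boundary := hγi
      range_boundary := hrange
      mark := D'.mark
      strictMono_mark := D'.strictMono_mark
      mark_mem := D'.mark_mem }
  exact ⟨E, hE₀, hγ0, hγ1, rfl⟩


/-- **Registered helper stub `stub_radoPeriodic`** (towards `stub_radoSqueezeFamily`, line `birth`): shifting the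
argument of `Int.fract` by one does not change it (the periodisation step), in closed form. [folklore] -/
theorem stub_radoPeriodic : ∀ (m₀ θ : ℝ), m₀ + Int.fract (θ + 1 - m₀) = m₀ + Int.fract (θ - m₀) := by
  intro m₀ θ
  rw [show θ + 1 - m₀ = (θ - m₀) + 1 by ring, Int.fract_add_one]

end Periodic

section Family

variable {D D' : DobrushinDomain} {F : Set ℝ} (xs : ℕ → ℝ)
  (d : ∀ n : ℕ, xs n ∈ F ∧ xs n ∈ Ioo (D'.mark 0) (D'.mark 0 + 1) → DefectData D D' F (xs n))
  (hex : ∀ y : ℝ, y ∈ F ∧ y ∈ Ioo (D'.mark 0) (D'.mark 0 + 1) →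
    ∃ n : ℕ, (xs n ∈ F ∧ xs n ∈ Ioo (D'.mark 0) (D'.mark 0 + 1)) ∧ xs n ∈ connectedComponentIn F y)
  (hF : F = {θ : ℝ | D'.boundary θ ∈ D.carrier}) (hsub : D'.carrier ⊆ D.carrier)
  (h0 : D'.pt 0 = D.pt 0) (h1 : D'.pt 1 = D.pt 1)

/-- The **treated set** at parameter `t`: representatives below `⌊1/t⌋`. [folklore] -/
def treated (F : Set ℝ) (m₀ : ℝ) (xs : ℕ → ℝ) (t : ℝ) : Finset ℕ := by
  classical
  exact (Finset.range ⌊1 / t⌋₊).filter fun n ↦ (xs n ∈ F ∧ xs n ∈ Ioo m₀ (m₀ + 1)) ∧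
    ∀ k < n, xs k ∈ F ∧ xs k ∈ Ioo m₀ (m₀ + 1) → connectedComponentIn F (xs k) ≠ connectedComponentIn F (xs n)

/-- Membership in the treated set. [folklore] -/
theorem mem_treated {m₀ t : ℝ} {n : ℕ} : n ∈ treated F m₀ xs t ↔ n < ⌊1 / t⌋₊ ∧
    ((xs n ∈ F ∧ xs n ∈ Ioo m₀ (m₀ + 1)) ∧
      ∀ k < n, xs k ∈ F ∧ xs k ∈ Ioo m₀ (m₀ + 1) → connectedComponentIn F (xs k) ≠ connectedComponentIn F (xs n))
          := by
  classical
  unfold treated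
  simp only [Finset.mem_filter, Finset.mem_range]

/-- The treated sets decrease in `t`. [folklore] -/
theorem treated_mono {m₀ s t : ℝ} (hs : 0 < s) (hst : s ≤ t) : treated F m₀ xs t ⊆ treated F m₀ xs s := by
  intro n hn
  rw [mem_treated] at hn ⊢
  exact ⟨lt_of_lt_of_le hn.1 (Nat.floor_mono (one_div_le_one_div_of_le hs hst)), hn.2⟩

/-- A fixed index is below `⌊1/t⌋` for small `t`. [folklore] -/
theorem lt_floor_of_lt {t : ℝ} (ht : 0 < t) {n : ℕ} (htn : t < 1 / ((n : ℝ) + 2)) : n < ⌊1 / t⌋₊ := by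
  have hn2 : (0 : ℝ) < (n : ℝ) + 2 := by positivity
  have h1t : (n : ℝ) + 2 ≤ 1 / t := by
    have := one_div_le_one_div_of_le ht htn.le
    rwa [one_div_one_div] at this
  have : n + 1 ≤ ⌊1 / t⌋₊ := Nat.le_floor (by push_cast; linarith)
  omega

/-- **The family of squeezed domains.** [folklore] -/
def levelE (t : ℝ) : DobrushinDomain :=
  if h : 0 < t ∧ t < 1 / 4 then
    (exists_level xs d hex hF hsub h0 h1 h.1 (by linarith [h.2]) (treated F (D'.mark 0) xs t)
      (fun _ hn ↦ (mem_treated xs |>.1 hn).2)).choose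
  else D

/-- The defining properties of the squeezed domain for `0 < t < 1/4`. [folklore] -/
theorem levelE_spec {t : ℝ} (h : 0 < t ∧ t < 1 / 4) :
    (levelE xs d hex hF hsub h0 h1 t).carrier = D.carrier \ ⋃ n ∈ treated F (D'.mark 0) xs t, bite xs d t n ∧
      (levelE xs d hex hF hsub h0 h1 t).pt 0 = D.pt 0 ∧ (levelE xs d hex hF hsub h0 h1 t).pt 1 = D.pt 1 ∧
      (levelE xs d hex hF hsub h0 h1 t).boundary = loopγ xs d hex t (treated F (D'.mark 0) xs t) := by
  unfold levelE
  rw [dif_pos h]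
  exact (exists_level xs d hex hF hsub h0 h1 h.1 (by linarith [h.2]) (treated F (D'.mark 0) xs t)
    (fun _ hn ↦ (mem_treated xs |>.1 hn).2)).choose_spec

/-- Outside `(0, 1/4)` the squeezed domain is `D`. [folklore] -/
theorem levelE_of_not {t : ℝ} (h : ¬ (0 < t ∧ t < 1 / 4)) : levelE xs d hex hF hsub h0 h1 t = D := by
  unfold levelE; rw [dif_neg h]

/-- **Containment and marked points**: `D' ⊆ levelE t ⊆ D`, with the marked points of `D`. [folklore] -/
theorem levelE_between (t : ℝ) :
    D'.carrier ⊆ (levelE xs d hex hF hsub h0 h1 t).carrier ∧ (levelE xs d hex hF hsub h0 h1 t).carrier ⊆ D.carrier ∧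
      (levelE xs d hex hF hsub h0 h1 t).pt 0 = D.pt 0 ∧ (levelE xs d hex hF hsub h0 h1 t).pt 1 = D.pt 1 := by
  by_cases h : 0 < t ∧ t < 1 / 4
  · obtain ⟨hc, hp0, hp1, -⟩ := levelE_spec xs d hex hF hsub h0 h1 h
    rw [hc]
    obtain ⟨hD'V, -⟩ := subset_level xs d hF hsub h0 h1 h.1 (treated F (D'.mark 0) xs t)
      (fun _ hn ↦ (mem_treated xs |>.1 hn).2)
    exact ⟨hD'V, Set.sdiff_subset, hp0, hp1⟩
  · rw [levelE_of_not xs d hex hF hsub h0 h1 h]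
    exact ⟨hsub, Subset.rfl, rfl, rfl⟩

/-! ### Chart points above the level are off the closure of the squeezed domain -/

include hF hsub h0 h1 in
/-- **Key lemma.** For a treated representative `n` at parameter `s` and a model point `z` with positive height
`im z > s` in the closed unit disc (off the base), the chart point `(d n).G z` is not in `closure (levelE s)`.
[folklore] -/
theorem G_notMem_closure_level {s : ℝ} (hs : 0 < s ∧ s < 1 / 4) {n : ℕ} (hn : n ∈ treated F (D'.mark 0) xs s)
    {z : ℂ} (hz1 : ‖z‖ ≤ 1) (hzs : s < z.im) :
    (d n (mem_treated xs |>.1 hn).2.1).G z ∉ closure (levelE xs d hex hF hsub h0 h1 s).carrier := by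
  obtain ⟨hc, -, -, -⟩ := levelE_spec xs d hex hF hsub h0 h1 hs
  rw [hc]
  have hgood := (mem_treated xs |>.1 hn).2.1
  set e := d n hgood with he
  have hpos : 0 < z.im := hs.1.trans hzs
  -- points of `G '' {s < im}` inside `U` are in the bite
  have hbite : ∀ z' : ℂ, ‖z'‖ < 1 → s < z'.im → e.G z' ∉ D.carrier \ ⋃ m ∈ treated F (D'.mark 0) xs s, bite xs d
      s m := by
    intro z' hz'1 hz's hmem
    apply hmem.2
    simp only [mem_iUnion, exists_prop]
    refine ⟨n, hn, ?_⟩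
    rw [bite_eq xs d s hgood]
    exact ⟨z', ⟨hz'1.le, hz's.le⟩, rfl⟩
  have hO₂ : e.G '' {z' : ℂ | s < z'.im} ∈ 𝓝 (e.G z) :=
    (e.G.isOpenMap _ (isOpen_lt continuous_const continuous_im)).mem_nhds ⟨z, hzs, rfl⟩
  rw [mem_closure_iff_nhds]
  push Not
  rcases hz1.lt_or_eq with hlt | heq
  · refine ⟨e.G '' {z' : ℂ | ‖z'‖ < 1 ∧ s < z'.im}, (e.G.isOpenMap _ ?_).mem_nhds ⟨z, ⟨hlt, hzs⟩, rfl⟩, ?_⟩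
    · exact (isOpen_lt continuous_norm continuous_const).inter (isOpen_lt continuous_const continuous_im)
    · rw [eq_empty_iff_forall_notMem]
      rintro _ ⟨⟨z', ⟨hz'1, hz's⟩, rfl⟩, hV⟩
      exact hbite z' hz'1 hz's hV
  · obtain ⟨v, hv, hvG⟩ := e.G_semicircle heq hpos
    obtain ⟨-, -, -, -, O₁, hO₁, hO₁U⟩ := e.beta_open_facts hF hsub h0 h1 hgood.1 hgood.2 hv
    rw [← hvG] at hO₁
    refine ⟨O₁ ∩ e.G '' {z' : ℂ | s < z'.im}, inter_mem hO₁ hO₂, ?_⟩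
    rw [eq_empty_iff_forall_notMem]
    rintro q ⟨⟨hq₁, ⟨z', hz's, rfl⟩⟩, hV⟩
    have hqU : e.G z' ∈ e.U := hO₁U ⟨hq₁, hV.1⟩
    rw [← e.hG3] at hqU
    obtain ⟨z'', ⟨hz''1, -⟩, hzz⟩ := hqU
    have := e.G.injective hzz
    subst this
    exact hbite z'' hz''1 hz's hV

/-! ### Separation -/

include hF hsub h0 h1 in
/-- **Separation**: `closure (levelE s) ∩ closure (D ∖ levelE t) = ∅` for `0 < s < t`. [folklore] -/
theorem levelE_separated {s t : ℝ} (hs : 0 < s) (hst : s < t) :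
    closure (levelE xs d hex hF hsub h0 h1 s).carrier ∩
      closure (D.carrier \ (levelE xs d hex hF hsub h0 h1 t).carrier) = ∅ := by
  by_cases ht : t < 1 / 4
  swap
  · rw [levelE_of_not xs d hex hF hsub h0 h1 (fun h ↦ ht h.2), sdiff_self, closure_empty, inter_empty]
  have ht' : 0 < t ∧ t < 1 / 4 := ⟨hs.trans hst, ht⟩
  have hs' : 0 < s ∧ s < 1 / 4 := ⟨hs, hst.trans ht⟩
  obtain ⟨hct, -, -, -⟩ := levelE_spec xs d hex hF hsub h0 h1 ht'
  have hclosed : IsClosed (⋃ n ∈ treated F (D'.mark 0) xs t, bite xs d t n) :=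
    (treated F (D'.mark 0) xs t).finite_toSet.isClosed_biUnion fun n hn ↦
      (bite_facts xs d hF hsub h0 h1 ht'.1 (mem_treated xs |>.1 hn).2.1).1
  rw [eq_empty_iff_forall_notMem]
  rintro w ⟨hws, hwt⟩
  rw [hct, sdiff_sdiff_right_self] at hwt
  have hwT : w ∈ ⋃ n ∈ treated F (D'.mark 0) xs t, bite xs d t n := closure_minimal inter_subset_right hclosed hwt
  simp only [mem_iUnion, exists_prop] at hwT
  obtain ⟨n, hn, hwn⟩ := hwT
  have hgood := (mem_treated xs |>.1 hn).2.1
  rw [bite_eq xs d t hgood] at hwn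
  obtain ⟨z, ⟨hz1, hzt⟩, rfl⟩ := hwn
  have hns : n ∈ treated F (D'.mark 0) xs s := treated_mono xs hs hst.le hn
  exact G_notMem_closure_level xs d hex hF hsub h0 h1 hs' hns hz1 (hst.trans_le hzt) hws

end Family

/-- **Registered helper stub `stub_radoFamilyA`** (towards `stub_radoSqueezeFamily`, line `birth`): the treated sets
decrease in the parameter, in closed form. [folklore] -/
theorem stub_radoFamilyA :
    ∀ (F : Set ℝ) (m₀ : ℝ) (xs : ℕ → ℝ) (s t : ℝ), 0 < s → s ≤ t →
      Summit.CriticalPhenomena.SAWScalingLimit.Theorems.RestrictionOfLimit.Birth.treated F m₀ xs t ⊆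
          Summit.CriticalPhenomena.SAWScalingLimit.Theorems.RestrictionOfLimit.Birth.treated F m₀ xs s :=
  fun _ _ xs _ _ hs hst ↦ treated_mono xs hs hst

end Summit.CriticalPhenomena.SAWScalingLimit.Theorems.RestrictionOfLimit.Birth

end
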